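import Summits.CriticalPhenomena.PercolationContinuityZ3.Theorems.SahiMasterFamilyFInequalityTwistedAD
import Mathlib.Algebra.BigOperators.Ring.Finset
import Mathlib.Data.Finset.Sups
import Mathlib.Data.Fintype.Powerset
import Mathlib.Tactic.Linarith
import Mathlib.Tactic.Ring
import HarnessLib

/-!
# Antipodal-Harris atoms and linear certificates for the weighted antipodal form of the `F`-inequality

Support file for the master-family `F`-inequality programme (`prim-master-conj` gen 24; `--supports stmt-CriticalPhenomena-4575`;
memo `run/shared/lean/prim/prim-l12/prim-master-conj/POINTWISE.md` §25.10).  No definition, no `sorry`, standard axioms.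

Setting: the cube `Finset κ` (`κ` finite) with complementation `s ↦ sᶜ`, a weight `ω ≥ 0` which is invariant under complementation and
satisfies the FKG lattice condition `ω s * ω t ≤ ω (s ∩ t) * ω (s ∪ t)`.  For families `U V : Finset (Finset κ)` write
`κ_ω(U,V) := Σ_{s ∈ U ∩ V} ω s − Σ_{s ∈ U ∩ Vᶜˢ} ω s` (`Vᶜˢ` = pointwise complements): the "antipodal Harris" functional of §25.10.

* `sum_inter_compls_le_sum_inter` — **`κ_ω(U,V) ≥ 0` for upper families `U, V`** (two FKG steps: `ω(U∩V)·ω(univ) ≥ ω(U)ω(V)` from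
  `TwistedAD.fkg_upperSet_of_latticeCondition`, and `ω(U ∩ Vᶜˢ)·ω(univ) ≤ ω(U)·ω(Vᶜˢ) = ω(U)ω(V)` because `(Vᶜˢ)ᶜ` is an upper family and
  `ω(Vᶜˢ) = ω(V)` by symmetry);
* `sum_mul_antipodalProduct_nonneg` — the point form: `Σ_s ω s · (𝟙_U s − 𝟙_U sᶜ)(𝟙_V s − 𝟙_V sᶜ) = 2 κ_ω(U,V) ≥ 0`;
* `weightedAntipodal_nonneg_of_certificate` — **LINEAR CERTIFICATES**: if upper families `U i, V i` and weights `λ i ≥ 0` (`i ∈ Fin m`) satisfy,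
  at every point `s`, `Σ_i λ i (𝟙_{U i} s − 𝟙_{U i} sᶜ)(𝟙_{V i} s − 𝟙_{V i} sᶜ) ≤ c s + c sᶜ` for a function `c`, then `Σ_s ω s · c s ≥ 0`.
  With `c s = 𝟙_{A∩B∩G}(s) − 𝟙_{A∩G}(s)𝟙_{B∩G}(sᶜ) − 𝟙_G(s)𝟙_{(A∩B)∖G}(sᶜ)` the conclusion is the weighted antipodal form `WF_comb` of §25 (V5)
  (`weightedFcomb_nonneg_of_certificate`), which by the hierarchy of §25.1 gives `F ≥ 0` for log-supermodular measures; conjecture (P-WF) of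
  §25.10 says such a certificate always exists (verified for all triples of `{0,1}^4` and 60,000 samples of `{0,1}^5`).

HONEST FRAMING: bookkeeping lemmas that turn an explicit (P-WF) certificate into a kernel inequality; no certificate rule is proved here and
`F ≥ 0` remains OPEN. [this work]
-/

namespace Summit.CriticalPhenomena.PercolationContinuityZ3.Theorems

namespace TwistedAD

open Finset
open scoped FinsetFamily

variable {κ : Type*} [Fintype κ] [DecidableEq κ]

/-- For a complement-invariant weight, the weight of the family of complements equals the weight of the family. [this work] -/
theorem sum_compls_eq (ω : Finset κ → ℝ) (hsym : ∀ s, ω sᶜ = ω s) (V : Finset (Finset κ)) :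
    ∑ s ∈ Vᶜˢ, ω s = ∑ s ∈ V, ω s := by
  rw [← image_compl, sum_image (fun s _ t _ h => compl_injective h)]
  exact sum_congr rfl fun s _ => hsym s

/-- The complement family of the complement-closure: `s ∈ (univ \ Vᶜˢ)` iff `sᶜ ∉ V`; this family is upper when `V` is upper. [this work] -/
theorem isUpperSet_sdiff_compls (V : Finset (Finset κ)) (hV : IsUpperSet (V : Set (Finset κ))) :
    IsUpperSet ((univ \ Vᶜˢ : Finset (Finset κ)) : Set (Finset κ)) := by
  intro s t hst hs
  simp only [coe_sdiff, coe_univ, Set.mem_sdiff, Set.mem_univ, true_and, mem_coe, mem_compls] at hs ⊢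
  intro ht
  exact hs (hV (compl_le_compl hst) ht)

/-- **Antipodal Harris atom, family form.**  For a nonnegative, complement-invariant weight `ω` on `Finset κ` with the FKG lattice condition
and upper families `U, V`:  `Σ_{s ∈ U ∩ Vᶜˢ} ω s ≤ Σ_{s ∈ U ∩ V} ω s`.  Proof: two FKG inequalities (see the module docstring). [this work] -/
theorem sum_inter_compls_le_sum_inter (ω : Finset κ → ℝ) (hω₀ : ∀ s, 0 ≤ ω s)
    (hω : ∀ s t, ω s * ω t ≤ ω (s ⊓ t) * ω (s ⊔ t)) (hsym : ∀ s, ω sᶜ = ω s)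
    (U V : Finset (Finset κ)) (hU : IsUpperSet (U : Set (Finset κ))) (hV : IsUpperSet (V : Set (Finset κ))) :
    ∑ s ∈ U ∩ Vᶜˢ, ω s ≤ ∑ s ∈ U ∩ V, ω s := by
  set M : ℝ := ∑ s, ω s with hM
  -- FKG for (U, V)
  have h1 : (∑ s ∈ U, ω s) * (∑ s ∈ V, ω s) ≤ M * ∑ s ∈ U ∩ V, ω s :=
    fkg_upperSet_of_latticeCondition ω hω₀ hω U V hU hV
  -- FKG for (U, univ \ Vᶜˢ)
  have h2 : (∑ s ∈ U, ω s) * (∑ s ∈ univ \ Vᶜˢ, ω s) ≤ M * ∑ s ∈ U ∩ (univ \ Vᶜˢ), ω s :=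
    fkg_upperSet_of_latticeCondition ω hω₀ hω U (univ \ Vᶜˢ) hU (isUpperSet_sdiff_compls V hV)
  -- partitions
  have hU_split : ∑ s ∈ U, ω s = ∑ s ∈ U ∩ Vᶜˢ, ω s + ∑ s ∈ U ∩ (univ \ Vᶜˢ), ω s := by
    rw [← sum_union]
    · congr 1
      ext s
      simp only [mem_union, mem_inter, mem_sdiff, mem_univ, true_and]
      tauto
    · exact disjoint_left.2 fun s hs hs' => (mem_sdiff.1 (mem_inter.1 hs').2).2 (mem_inter.1 hs).2
  have huniv_split : M = ∑ s ∈ Vᶜˢ, ω s + ∑ s ∈ univ \ Vᶜˢ, ω s := by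
    rw [hM, ← sum_union disjoint_sdiff, union_sdiff_of_subset (subset_univ _)]
  have hVc : ∑ s ∈ Vᶜˢ, ω s = ∑ s ∈ V, ω s := sum_compls_eq ω hsym V
  -- nonnegativity facts
  have hUn : 0 ≤ ∑ s ∈ U, ω s := sum_nonneg fun s _ => hω₀ s
  have hXn : 0 ≤ ∑ s ∈ U ∩ Vᶜˢ, ω s := sum_nonneg fun s _ => hω₀ s
  have hYn : 0 ≤ ∑ s ∈ U ∩ V, ω s := sum_nonneg fun s _ => hω₀ s
  have hMn : 0 ≤ M := sum_nonneg fun s _ => hω₀ s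
  -- M * X ≤ (ΣU)(ΣV) ≤ M * Y, where X = Σ_{U∩Vᶜˢ}, Y = Σ_{U∩V}
  have key : M * ∑ s ∈ U ∩ Vᶜˢ, ω s ≤ M * ∑ s ∈ U ∩ V, ω s := by
    have e1 : M * ∑ s ∈ U ∩ Vᶜˢ, ω s
        = M * (∑ s ∈ U, ω s) - M * ∑ s ∈ U ∩ (univ \ Vᶜˢ), ω s := by rw [hU_split]; ring
    have e2 : (∑ s ∈ U, ω s) * (∑ s ∈ V, ω s)
        = M * (∑ s ∈ U, ω s) - (∑ s ∈ U, ω s) * (∑ s ∈ univ \ Vᶜˢ, ω s) := by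
      rw [← hVc]
      have : ∑ s ∈ Vᶜˢ, ω s = M - ∑ s ∈ univ \ Vᶜˢ, ω s := by rw [huniv_split]; ring
      rw [this]; ring
    calc M * ∑ s ∈ U ∩ Vᶜˢ, ω s
        = M * (∑ s ∈ U, ω s) - M * ∑ s ∈ U ∩ (univ \ Vᶜˢ), ω s := e1
      _ ≤ M * (∑ s ∈ U, ω s) - (∑ s ∈ U, ω s) * (∑ s ∈ univ \ Vᶜˢ, ω s) := by linarith [h2]
      _ = (∑ s ∈ U, ω s) * (∑ s ∈ V, ω s) := e2.symm
      _ ≤ M * ∑ s ∈ U ∩ V, ω s := h1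
  -- conclude: if M = 0 all weights vanish
  rcases hMn.eq_or_lt with hM0 | hMpos
  · have hzero : ∀ s, ω s = 0 := by
      intro s
      have := (sum_eq_zero_iff_of_nonneg (fun t _ => hω₀ t)).1 hM0.symm s (mem_univ s)
      exact this
    simp [hzero]
  · exact le_of_mul_le_mul_left key hMpos

/-- **Antipodal Harris atom, point form.**  With the same hypotheses, for upper families `U, V`:
`0 ≤ Σ_s ω s · (𝟙_U(s) − 𝟙_U(sᶜ)) · (𝟙_V(s) − 𝟙_V(sᶜ))` (the sum equals `2 κ_ω(U,V)`). [this work] -/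
theorem sum_mul_antipodalProduct_nonneg (ω : Finset κ → ℝ) (hω₀ : ∀ s, 0 ≤ ω s)
    (hω : ∀ s t, ω s * ω t ≤ ω (s ⊓ t) * ω (s ⊔ t)) (hsym : ∀ s, ω sᶜ = ω s)
    (U V : Finset (Finset κ)) (hU : IsUpperSet (U : Set (Finset κ))) (hV : IsUpperSet (V : Set (Finset κ))) :
    0 ≤ ∑ s, ω s * (((if s ∈ U then (1 : ℝ) else 0) - (if sᶜ ∈ U then 1 else 0))
                    * ((if s ∈ V then (1 : ℝ) else 0) - (if sᶜ ∈ V then 1 else 0))) := by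
  -- the four indicator sums
  have hA : ∑ s, ω s * ((if s ∈ U then (1 : ℝ) else 0) * (if s ∈ V then (1 : ℝ) else 0)) = ∑ s ∈ U ∩ V, ω s := by
    rw [← univ_inter (U ∩ V), ← sum_ite_mem]
    refine sum_congr rfl fun s _ => ?_
    by_cases h1 : s ∈ U <;> by_cases h2 : s ∈ V <;> simp [h1, h2, mem_inter]
  have hB : ∑ s, ω s * ((if s ∈ U then (1 : ℝ) else 0) * (if sᶜ ∈ V then (1 : ℝ) else 0)) = ∑ s ∈ U ∩ Vᶜˢ, ω s := by
    rw [← univ_inter (U ∩ Vᶜˢ), ← sum_ite_mem]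
    refine sum_congr rfl fun s _ => ?_
    by_cases h1 : s ∈ U <;> by_cases h2 : sᶜ ∈ V <;> simp [h1, h2, mem_inter, mem_compls]
  -- the two "complemented" sums equal the first two after the substitution s ↦ sᶜ
  have hC : ∑ s, ω s * ((if sᶜ ∈ U then (1 : ℝ) else 0) * (if sᶜ ∈ V then (1 : ℝ) else 0))
      = ∑ s, ω s * ((if s ∈ U then (1 : ℝ) else 0) * (if s ∈ V then (1 : ℝ) else 0)) := by
    exact Fintype.sum_equiv (compl_involutive.toPerm _) _ _ fun s => by simp [hsym]
  have hD : ∑ s, ω s * ((if sᶜ ∈ U then (1 : ℝ) else 0) * (if s ∈ V then (1 : ℝ) else 0))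
      = ∑ s, ω s * ((if s ∈ U then (1 : ℝ) else 0) * (if sᶜ ∈ V then (1 : ℝ) else 0)) := by
    exact Fintype.sum_equiv (compl_involutive.toPerm _) _ _ fun s => by simp [hsym]
  have key := sum_inter_compls_le_sum_inter ω hω₀ hω hsym U V hU hV
  -- expand the product
  have expand : ∑ s, ω s * (((if s ∈ U then (1 : ℝ) else 0) - (if sᶜ ∈ U then 1 else 0))
                    * ((if s ∈ V then (1 : ℝ) else 0) - (if sᶜ ∈ V then 1 else 0)))
      = ∑ s, ω s * ((if s ∈ U then (1 : ℝ) else 0) * (if s ∈ V then (1 : ℝ) else 0))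
        - ∑ s, ω s * ((if s ∈ U then (1 : ℝ) else 0) * (if sᶜ ∈ V then (1 : ℝ) else 0))
        - ∑ s, ω s * ((if sᶜ ∈ U then (1 : ℝ) else 0) * (if s ∈ V then (1 : ℝ) else 0))
        + ∑ s, ω s * ((if sᶜ ∈ U then (1 : ℝ) else 0) * (if sᶜ ∈ V then (1 : ℝ) else 0)) := by
    rw [← sum_sub_distrib, ← sum_sub_distrib, ← sum_add_distrib]
    exact sum_congr rfl fun s _ => by ring
  rw [expand, hC, hD, hA, hB]
  linarith

/-- **Linear certificates.**  Let `ω ≥ 0` be complement-invariant with the FKG lattice condition.  Suppose upper families `U i, V i` and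
weights `lam i ≥ 0` (`i : Fin m`) satisfy, at every point `s`,
`Σ_i lam i · (𝟙_{U i}(s) − 𝟙_{U i}(sᶜ))(𝟙_{V i}(s) − 𝟙_{V i}(sᶜ)) ≤ c s + c sᶜ`.  Then `0 ≤ Σ_s ω s · c s`.
(`2 Σ ω c = Σ ω (c + c∘ᶜ) ≥ Σ_i lam i · [point form of the atom] ≥ 0`.) [this work] -/
theorem weightedAntipodal_nonneg_of_certificate (ω : Finset κ → ℝ) (hω₀ : ∀ s, 0 ≤ ω s)
    (hω : ∀ s t, ω s * ω t ≤ ω (s ⊓ t) * ω (s ⊔ t)) (hsym : ∀ s, ω sᶜ = ω s)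
    {m : ℕ} (Us Vs : Fin m → Finset (Finset κ)) (lam : Fin m → ℝ) (hlam : ∀ i, 0 ≤ lam i)
    (hUs : ∀ i, IsUpperSet (Us i : Set (Finset κ))) (hVs : ∀ i, IsUpperSet (Vs i : Set (Finset κ)))
    (c : Finset κ → ℝ)
    (hcert : ∀ s, ∑ i, lam i * (((if s ∈ Us i then (1 : ℝ) else 0) - (if sᶜ ∈ Us i then 1 else 0))
                    * ((if s ∈ Vs i then (1 : ℝ) else 0) - (if sᶜ ∈ Vs i then 1 else 0))) ≤ c s + c sᶜ) :
    0 ≤ ∑ s, ω s * c s := by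
  have hsymc : ∑ s, ω s * c sᶜ = ∑ s, ω s * c s :=
    Fintype.sum_equiv (compl_involutive.toPerm _) _ _ fun s => by simp [hsym]
  have hsplit : ∑ s, ω s * (c s + c sᶜ) = ∑ s, ω s * c s + ∑ s, ω s * c sᶜ := by
    rw [← sum_add_distrib]
    exact sum_congr rfl fun s _ => by ring
  have h2 : 2 * ∑ s, ω s * c s = ∑ s, ω s * (c s + c sᶜ) := by
    rw [hsplit, hsymc, two_mul]
  have hlow : ∑ s, ω s * (∑ i, lam i * (((if s ∈ Us i then (1 : ℝ) else 0) - (if sᶜ ∈ Us i then 1 else 0))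
                    * ((if s ∈ Vs i then (1 : ℝ) else 0) - (if sᶜ ∈ Vs i then 1 else 0))))
      ≤ ∑ s, ω s * (c s + c sᶜ) :=
    sum_le_sum fun s _ => mul_le_mul_of_nonneg_left (hcert s) (hω₀ s)
  have hswap : ∑ s, ω s * (∑ i, lam i * (((if s ∈ Us i then (1 : ℝ) else 0) - (if sᶜ ∈ Us i then 1 else 0))
                    * ((if s ∈ Vs i then (1 : ℝ) else 0) - (if sᶜ ∈ Vs i then 1 else 0))))
      = ∑ i, lam i * ∑ s, ω s * (((if s ∈ Us i then (1 : ℝ) else 0) - (if sᶜ ∈ Us i then 1 else 0))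
                    * ((if s ∈ Vs i then (1 : ℝ) else 0) - (if sᶜ ∈ Vs i then 1 else 0))) := by
    simp_rw [mul_sum]
    rw [sum_comm]
    exact sum_congr rfl fun i _ => sum_congr rfl fun s _ => by ring
  have hpos : 0 ≤ ∑ i, lam i * ∑ s, ω s * (((if s ∈ Us i then (1 : ℝ) else 0) - (if sᶜ ∈ Us i then 1 else 0))
                    * ((if s ∈ Vs i then (1 : ℝ) else 0) - (if sᶜ ∈ Vs i then 1 else 0))) :=
    sum_nonneg fun i _ => mul_nonneg (hlam i) (sum_mul_antipodalProduct_nonneg ω hω₀ hω hsym (Us i) (Vs i) (hUs i) (hVs i))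
  linarith [hlow, hswap, h2, hpos]

/-- **The weighted antipodal form of `F` from a certificate.**  For families `A, B, G` (no hypothesis on them is needed here) put
`c s := 𝟙_{A∩B∩G}(s) − 𝟙_{A∩G}(s)·𝟙_{B∩G}(sᶜ) − 𝟙_G(s)·𝟙_{(A∩B)∖G}(sᶜ)`.  A pointwise linear certificate as in
`weightedAntipodal_nonneg_of_certificate` yields `WF_comb(ω) = Σ_s ω s · c s ≥ 0` for every complement-invariant FKG weight `ω`
(POINTWISE §25.10 (I3): conjecturally such a certificate always exists). [this work] -/
theorem weightedFcomb_nonneg_of_certificate (ω : Finset κ → ℝ) (hω₀ : ∀ s, 0 ≤ ω s)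
    (hω : ∀ s t, ω s * ω t ≤ ω (s ⊓ t) * ω (s ⊔ t)) (hsym : ∀ s, ω sᶜ = ω s)
    (A B G : Finset (Finset κ))
    {m : ℕ} (Us Vs : Fin m → Finset (Finset κ)) (lam : Fin m → ℝ) (hlam : ∀ i, 0 ≤ lam i)
    (hUs : ∀ i, IsUpperSet (Us i : Set (Finset κ))) (hVs : ∀ i, IsUpperSet (Vs i : Set (Finset κ)))
    (hcert : ∀ s, ∑ i, lam i * (((if s ∈ Us i then (1 : ℝ) else 0) - (if sᶜ ∈ Us i then 1 else 0))
                    * ((if s ∈ Vs i then (1 : ℝ) else 0) - (if sᶜ ∈ Vs i then 1 else 0)))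
        ≤ ((if s ∈ A ∩ B ∩ G then (1 : ℝ) else 0) - (if s ∈ A ∩ G then (1 : ℝ) else 0) * (if sᶜ ∈ B ∩ G then 1 else 0)
              - (if s ∈ G then (1 : ℝ) else 0) * (if sᶜ ∈ (A ∩ B) \ G then 1 else 0))
          + ((if sᶜ ∈ A ∩ B ∩ G then (1 : ℝ) else 0) - (if sᶜ ∈ A ∩ G then (1 : ℝ) else 0) * (if sᶜᶜ ∈ B ∩ G then 1 else 0)
              - (if sᶜ ∈ G then (1 : ℝ) else 0) * (if sᶜᶜ ∈ (A ∩ B) \ G then 1 else 0))) :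
    0 ≤ ∑ s, ω s * ((if s ∈ A ∩ B ∩ G then (1 : ℝ) else 0) - (if s ∈ A ∩ G then (1 : ℝ) else 0) * (if sᶜ ∈ B ∩ G then 1 else 0)
              - (if s ∈ G then (1 : ℝ) else 0) * (if sᶜ ∈ (A ∩ B) \ G then 1 else 0)) :=
  weightedAntipodal_nonneg_of_certificate ω hω₀ hω hsym Us Vs lam hlam hUs hVs
    (fun s => (if s ∈ A ∩ B ∩ G then (1 : ℝ) else 0) - (if s ∈ A ∩ G then (1 : ℝ) else 0) * (if sᶜ ∈ B ∩ G then 1 else 0)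
              - (if s ∈ G then (1 : ℝ) else 0) * (if sᶜ ∈ (A ∩ B) \ G then 1 else 0)) hcert

end TwistedAD

end Summit.CriticalPhenomena.PercolationContinuityZ3.Theorems
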